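import Summits.QuantumFields.YangMills.Theorems.FlatTubeReductionGaussProfileNumbersII
import Summits.QuantumFields.YangMills.Theorems.LuscherReductionTwistedTraceScalingBOStiffFibreTail
import Summits.QuantumFields.YangMills.Theorems.LuscherReductionTwistedTraceScalingBORecordGamma
import HarnessLib

/-!
# SQUARED-PROFILE NUMBERS: polynomial fibre moments of `Ω_c²·w_u` at EVERY slow datum `u` are `O(γ)` —
# `∫ recordProfile β (x̂)²·M(x)·softWeight χ (orthoTube u x) dπ ≤ (1+κ)·A_k·D·recordGamma β` for weights `0 ≤ M ≤ D·(balLevel β + 1)^k`, any window constant `K`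
# (route `FlatTubeReduction`, crux K1 `NearFlatRatioLaw` stmt-QuantumFields-24720; seat `ym-line-ftr-p1` g17; rate twin «ratepack-v6», stub `stub_hODpot_A` (C2-moments) and the K-port of
# `stub_hST_A`; R2b1 RECORD rung — no summit statement is proved here)

WHY (crux workfile `Lines/ratepack-v6-port-g17.md` §5).  The (C2)-rate of `stub_hODpot_A` needs the transport defect bounded in `L²(Ω_c²·w_u dπ)` with polynomial weights `(β‖x‖²)^k`
KEPT under the integral (not sup'd over the fibre support, which costs `log^{2k}β`); lane A's `…BOStiffCoreCoeff.fibre_sq_mass_le` is the case `k = 0`, `K = 43`.  On a cap-balanced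
fibre point `Ω_c(x̂)²·w_u(x) = 𝟙_{‖x̂‖≤r_B}·S_β(x)·𝟙_F·N(orthoTube u x)` with the SQUARED integrand `S_β = e^{−2q_{β/2,β}}·e^{−‖P_Γx̂‖²β²}` (`…BOStiffFibreTail.recordProfile_sq_mul_softWeight_eq`,
any `K`), and `recordGamma β = N̄·∫𝟙S_β dπ` (`…BORecordGamma.recordGamma_eq`).  `S_β` is sandwiched by the SAME anisotropic Gaussians as the profile (`e^{−99N} ≤ 𝟙S_β ≤ e^{−c₂N}`,
`c₂ = min 1 (2−2cos(2π/L))`), so this generation's machine applies: numerator by `…GaussProfileNumbersII.orthoTransverse_gauss_moment_le`, denominator by a GENERIC core floor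
(`core_floor_of_exp_lower`, the proof of `recordProfile_core_floor` for any integrand with a Gaussian lower bound on the support).
* §1 ★★ `core_floor_of_exp_lower`; §2 `sqIntegrand_le_exp_neg`, `exp_neg_le_sqIntegrand`, `measurable_sqIntegrand`;
* §3 ★★★ `sqIntegrand_moment_le` — `∃ A β₃, ∀ β ≥ β₃, ∀ k D M, ∫ 𝟙S_β·M dπ ≤ A·(5e2^k4^dk!d!·c₂^{-(k+d)})·D·∫ 𝟙S_β dπ`;
* §4 ★★★ `fibre_weighted_sq_mass_le` — for every `s K M u` and (P) `gaugeAvg χ ≤ N̄(1+κ)` on the fat tube: `∫ Ω_c²·M·w_u dπ ≤ (1+κ)·A·(…)·D·recordGamma β` (`β ≥ β₃`).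
HONEST FRAMING: elementary on top of the landed Gaussian-number files; the pointwise weighted transport defect ((C2) proper) and (C1)-rate remain; femto rung R2b1 (RECORD label);
not infinite volume, not a gap, not Clay.  No defs, no named facts, no `sorry`.
-/

set_option autoImplicit false

noncomputable section

open MeasureTheory Filter Topology Real
open scoped BigOperators RealInnerProductSpace
open Literature.MathematicalPhysics.QuantumFieldTheory
open Literature.MathematicalPhysics.QuantumLattice

namespace Summit.QuantumFields.YangMills.Theorems.FemtoTransferGap.TwoLattice.ConstTube

open Summit.QuantumFields.YangMills.Theorems.FemtoTransferGap
open Summit.QuantumFields.YangMills.Theorems.FemtoTransferGap.TwoLattice.Stiff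
open Summit.QuantumFields.YangMills.Theorems.FemtoTransferGap.TwoLattice.Toron
open Summit.QuantumFields.YangMills.Theorems.FemtoTransferGap.TwoLattice.GnChart
open Summit.QuantumFields.YangMills.Theorems.FemtoTransferGap.TwoLattice.Avg
open Summit.QuantumFields.YangMills.Theorems.FemtoTransferGap.RateTube

variable (L : ℕ) [NeZero L]

/-! ## §1 A generic core floor -/

/-- ★★ **GENERIC CORE FLOOR.**  For `κ ≥ 0` there are `k₀ > 0` and `β₂ ≥ 400` such that for `β ≥ β₂` and every measurable bounded `g ≥ 0` supported in `‖x̂‖ ≤ r_B(β)` with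
`g(v) ≥ e^{−κ·balLevel β v}` at cap-balanced `v` with `‖x̂‖ ≤ r_B(β)`:  `k₀·v_β ≤ ∫_{coreBox β} g dπ` (the proof of `recordProfile_core_floor`, verbatim, for a general integrand).
[cite: Luscher1983, §3] -/
theorem core_floor_of_exp_lower {κ : ℝ} (hκ : 0 ≤ κ) :
    ∃ k₀ β₂ : ℝ, 0 < k₀ ∧ 400 ≤ β₂ ∧ ∀ β : ℝ, β₂ ≤ β → ∀ g : (Edge 3 L → Fin 3 → ℝ) → ℝ, Measurable g → (∀ v, 0 ≤ g v) → (∃ B : ℝ, ∀ v, g v ≤ B) →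
      (∀ v, g v ≠ 0 → ‖linkEmbed L v‖ ≤ min (1 / 40) (powScale (1 / 2) β * btLog β)) →
      (∀ v, v ∈ capBalancedSet L → ‖linkEmbed L v‖ ≤ min (1 / 40) (powScale (1 / 2) β * btLog β) → Real.exp (-(κ * balLevel L β v)) ≤ g v) →
      k₀ * (volume {w : {e : Edge 3 L // ¬e.1 = 0} → Fin 3 → ℝ | balLevel L β (balExt L w) ≤ 1}).toReal ≤ ∫ v in coreBox L β, g v ∂orthoTransverse L := by
  obtain ⟨r₀, hr₀, c, C, hc, hC, h⟩ := orthoTransverse_integral_two_sided L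
  obtain ⟨β₁, hβ₁⟩ := Filter.eventually_atTop.mp (eventually_recordRadius_lt hr₀)
  set d := Module.finrank ℝ ({e : Edge 3 L // ¬e.1 = 0} → Fin 3 → ℝ) with hd
  refine ⟨c * (Real.exp (-(κ / 4)) * (1 / 2) ^ d), max β₁ 400, by positivity, le_max_right _ _, fun β hβ g hgm hg0 hgB hgs hlow => ?_⟩
  have hrad := hβ₁ β ((le_max_left _ _).trans hβ)
  have hβ400 : 400 ≤ β := (le_max_right _ _).trans hβ
  have hβ1 : 1 ≤ β := by linarith
  obtain ⟨B, hB⟩ := hgB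
  -- the integrand `G = 𝟙_{coreBox β}·g`
  set G : (Edge 3 L → Fin 3 → ℝ) → ℝ := (coreBox L β).indicator g with hG
  have hGm : Measurable G := hgm.indicator (measurableSet_coreBox L β)
  have hG0 : ∀ v, 0 ≤ G v := fun v => Set.indicator_nonneg (fun v _ => hg0 v) v
  have hGB : ∀ v, G v ≤ max B 0 := fun v => Set.indicator_le' (fun v _ => (hB v).trans (le_max_left _ _)) (fun _ _ => le_max_right _ _) v
  have hGs : ∀ v, G v ≠ 0 → ‖v‖ < r₀ := fun v hv0 => by
    have hv : v ∈ coreBox L β := by by_contra hn; exact hv0 (Set.indicator_of_notMem hn _)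
    rw [hG, Set.indicator_of_mem hv] at hv0
    exact ((norm_le_norm_linkEmbed L v).trans (hgs v hv0)).trans_lt hrad
  have hlowT := (h G hGm hG0 ⟨max B 0, hGB⟩ hGs).1
  rw [← integral_indicator (measurableSet_coreBox L β)]
  refine le_trans ?_ hlowT
  have hSm := measurableSet_sublevel L β (1 / 4)
  have hint : Integrable (fun w : {e : Edge 3 L // ¬e.1 = 0} → Fin 3 → ℝ => G (balExt L w)) := by
    have hmaj : Integrable (fun w : {e : Edge 3 L // ¬e.1 = 0} → Fin 3 → ℝ =>
        (Metric.closedBall (0 : {e : Edge 3 L // ¬e.1 = 0} → Fin 3 → ℝ) 1).indicator (fun _ => max B 0) w) :=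
      (integrable_indicator_iff measurableSet_closedBall).2 (integrableOn_const (measure_closedBall_lt_top.ne))
    refine hmaj.mono' (hGm.comp (balExt L).continuous.measurable).aestronglyMeasurable (ae_of_all _ fun w => ?_)
    rw [Real.norm_eq_abs, abs_of_nonneg (hG0 _)]
    by_cases hw : G (balExt L w) = 0
    · rw [hw]; exact Set.indicator_nonneg (fun _ _ => le_max_right _ _) _
    · have hv : balExt L w ∈ coreBox L β := by by_contra hn; exact hw (Set.indicator_of_notMem hn _)
      rw [Set.indicator_of_mem (mem_closedBall_of_linkEmbed_le L (hv.2.1.trans ((inv_le_one_of_one_le₀ (by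
        rw [show (1 : ℝ) = Real.sqrt 1 by rw [Real.sqrt_one]]; exact Real.sqrt_le_sqrt hβ1)))))]
      exact hGB _
  have hpt : ∀ w : {e : Edge 3 L // ¬e.1 = 0} → Fin 3 → ℝ,
      {w : {e : Edge 3 L // ¬e.1 = 0} → Fin 3 → ℝ | balLevel L β (balExt L w) ≤ 1 / 4}.indicator (fun _ => Real.exp (-(κ / 4))) w ≤ G (balExt L w) := fun w => by
    by_cases hw : balLevel L β (balExt L w) ≤ 1 / 4
    · obtain ⟨hcore, hcap, hsup⟩ := mem_coreBox_of_balLevel_le L hβ400 (balExt_mem_balancedSet L w) hw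
      rw [Set.indicator_of_mem (show w ∈ {w : {e : Edge 3 L // ¬e.1 = 0} → Fin 3 → ℝ | balLevel L β (balExt L w) ≤ 1 / 4} from hw), hG,
        Set.indicator_of_mem hcore]
      refine le_trans (Real.exp_le_exp.2 ?_) (hlow _ hcap hsup)
      nlinarith [balLevel_nonneg L (by linarith : (0 : ℝ) ≤ β) (balExt L w)]
    · rw [Set.indicator_of_notMem (show w ∉ {w : {e : Edge 3 L // ¬e.1 = 0} → Fin 3 → ℝ | balLevel L β (balExt L w) ≤ 1 / 4} from hw)]
      exact hG0 _
  have hmono := integral_mono_of_nonneg (μ := (volume : Measure ({e : Edge 3 L // ¬e.1 = 0} → Fin 3 → ℝ)))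
    (ae_of_all _ fun w => Set.indicator_nonneg (fun _ _ => (Real.exp_pos _).le) w) hint (ae_of_all _ hpt)
  rw [integral_indicator_const _ hSm, smul_eq_mul, measureReal_def, volume_real_sublevel_quarter L β] at hmono
  calc c * (Real.exp (-(κ / 4)) * (1 / 2) ^ d) * (volume {w : {e : Edge 3 L // ¬e.1 = 0} → Fin 3 → ℝ | balLevel L β (balExt L w) ≤ 1}).toReal
      = c * ((1 / 2) ^ d * (volume {w : {e : Edge 3 L // ¬e.1 = 0} → Fin 3 → ℝ | balLevel L β (balExt L w) ≤ 1}).toReal * Real.exp (-(κ / 4))) := by ring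
    _ ≤ c * ∫ w, G (balExt L w) := mul_le_mul_of_nonneg_left hmono hc.le

/-! ## §2 The squared record integrand `𝟙_{‖x̂‖≤r_B}·e^{−2q}·e^{−‖P_Γx̂‖²/β^{-2}}` -/

/-- The squared integrand is measurable. [folklore] -/
theorem measurable_sqIntegrand (β : ℝ) :
    Measurable fun v : Edge 3 L → Fin 3 → ℝ => {v : Edge 3 L → Fin 3 → ℝ | ‖linkEmbed L v‖ ≤ min (1 / 40) (powScale (1 / 2) β * btLog β)}.indicator (fun _ => (1 : ℝ)) v *
      (Real.exp (-(stiffGaussExp L (β / 2) β (linkEmbed L v))) ^ 2 * Real.exp (-(‖(gaugeModes L).starProjection (linkEmbed L v)‖ ^ 2 / powScale 1 β ^ 2))) :=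
  ((measurable_const.indicator (measurableSet_le (measurable_linkEmbed L).norm measurable_const))).mul (measurable_record_integrand (L := L) β)

/-- **UPPER GAUSSIAN BOUND for the squared integrand**: at a cap-balanced `v`, `β ≥ 1`, `L ≥ 2`:
`𝟙·e^{−2q}·e^{−‖P_Γx̂‖²/β^{-2}} ≤ e^{−c₂·balLevel β v}`, `c₂ = min 1 (2 − 2cos(2π/L))`. [cite: Luscher1983, §3] -/
theorem sqIntegrand_le_exp_neg (hL : 2 ≤ L) {β : ℝ} (hβ : 1 ≤ β) {v : Edge 3 L → Fin 3 → ℝ} (hv : v ∈ capBalancedSet L) :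
    {v : Edge 3 L → Fin 3 → ℝ | ‖linkEmbed L v‖ ≤ min (1 / 40) (powScale (1 / 2) β * btLog β)}.indicator (fun _ => (1 : ℝ)) v *
        (Real.exp (-(stiffGaussExp L (β / 2) β (linkEmbed L v))) ^ 2 * Real.exp (-(‖(gaugeModes L).starProjection (linkEmbed L v)‖ ^ 2 / powScale 1 β ^ 2))) ≤
      Real.exp (-(min 1 (2 - 2 * Real.cos (2 * Real.pi / L)) * balLevel L β v)) := by
  have hβ0 : 0 < β := by linarith
  set x := linkEmbed L v
  have hx : ∀ c ∈ constModes L, ⟪c, x⟫ = 0 := fun c hc => inner_constMode_linkEmbed_eq_zero hc hv.1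
  obtain ⟨hq, -⟩ := shell_exponent_ge hL (show (0 : ℝ) ≤ β / 2 by positivity) hβ0.le (b := β) hx
  have hp : powScale 1 β = β⁻¹ := by rw [powScale_eq hβ, Real.rpow_neg hβ0.le, Real.rpow_one]
  have hind : {v : Edge 3 L → Fin 3 → ℝ | ‖linkEmbed L v‖ ≤ min (1 / 40) (powScale (1 / 2) β * btLog β)}.indicator (fun _ => (1 : ℝ)) v ≤ 1 :=
    Set.indicator_le_self' (fun _ _ => zero_le_one) v
  have hind0 : 0 ≤ {v : Edge 3 L → Fin 3 → ℝ | ‖linkEmbed L v‖ ≤ min (1 / 40) (powScale (1 / 2) β * btLog β)}.indicator (fun _ => (1 : ℝ)) v :=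
    Set.indicator_nonneg (fun _ _ => zero_le_one) v
  set c := min 1 (2 - 2 * Real.cos (2 * Real.pi / L)) with hc
  have hc1 : c ≤ 1 := min_le_left _ _
  have hc2 : c ≤ 2 - 2 * Real.cos (2 * Real.pi / L) := min_le_right _ _
  have hG : 0 ≤ ‖(gaugeModes L).starProjection x‖ ^ 2 := sq_nonneg _
  have hS : 0 ≤ ‖x - (gaugeModes L).starProjection x‖ ^ 2 := sq_nonneg _
  have hE : Real.exp (-(stiffGaussExp L (β / 2) β x)) ^ 2 * Real.exp (-(‖(gaugeModes L).starProjection x‖ ^ 2 / powScale 1 β ^ 2)) ≤ Real.exp (-(c * balLevel L β v)) := by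
    rw [← Real.exp_nat_mul, ← Real.exp_add, hp, inv_pow, div_inv_eq_mul]
    refine Real.exp_le_exp.2 ?_
    unfold balLevel
    have h2 : c * (β * ‖x - (gaugeModes L).starProjection x‖ ^ 2) ≤ 2 * stiffGaussExp L (β / 2) β x := by
      calc c * (β * ‖x - (gaugeModes L).starProjection x‖ ^ 2) ≤ (2 - 2 * Real.cos (2 * Real.pi / L)) * (β * ‖x - (gaugeModes L).starProjection x‖ ^ 2) :=
            mul_le_mul_of_nonneg_right hc2 (by positivity)
        _ = 2 * (β / 2 * (2 - 2 * Real.cos (2 * Real.pi / L)) * ‖x - (gaugeModes L).starProjection x‖ ^ 2) := by ring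
        _ ≤ 2 * stiffGaussExp L (β / 2) β x := by linarith
    have h3 : c * (β ^ 2 * ‖(gaugeModes L).starProjection x‖ ^ 2) ≤ ‖(gaugeModes L).starProjection x‖ ^ 2 * β ^ 2 := by
      have : 0 ≤ β ^ 2 * ‖(gaugeModes L).starProjection x‖ ^ 2 := by positivity
      nlinarith
    push_cast
    rw [mul_add]; linarith
  calc _ ≤ 1 * (Real.exp (-(stiffGaussExp L (β / 2) β x)) ^ 2 * Real.exp (-(‖(gaugeModes L).starProjection x‖ ^ 2 / powScale 1 β ^ 2))) :=
        mul_le_mul_of_nonneg_right hind (by positivity)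
    _ ≤ _ := by rw [one_mul]; exact hE

/-- **LOWER GAUSSIAN BOUND for the squared integrand**: at a cap-balanced `v` inside the support ball, `β ≥ 1`: `e^{−99·balLevel β v} ≤ 𝟙·e^{−2q}·e^{−‖P_Γx̂‖²/β^{-2}}`
(`q_{β/2,β}(x̂) ≤ 49β‖x̂‖² ≤ 49N`, `β²‖P_Γx̂‖² ≤ N`). [folklore] -/
theorem exp_neg_le_sqIntegrand {β : ℝ} (hβ : 1 ≤ β) {v : Edge 3 L → Fin 3 → ℝ} (hr : ‖linkEmbed L v‖ ≤ min (1 / 40) (powScale (1 / 2) β * btLog β)) :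
    Real.exp (-(99 * balLevel L β v)) ≤
      {v : Edge 3 L → Fin 3 → ℝ | ‖linkEmbed L v‖ ≤ min (1 / 40) (powScale (1 / 2) β * btLog β)}.indicator (fun _ => (1 : ℝ)) v *
        (Real.exp (-(stiffGaussExp L (β / 2) β (linkEmbed L v))) ^ 2 * Real.exp (-(‖(gaugeModes L).starProjection (linkEmbed L v)‖ ^ 2 / powScale 1 β ^ 2))) := by
  have hβ0 : 0 < β := by linarith
  set x := linkEmbed L v
  have hq : stiffGaussExp L (β / 2) β x ≤ (96 * (β / 2) + β) * ‖x‖ ^ 2 := stiffGaussExp_le_mul_norm_sq (by positivity) hβ0.le x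
  have hp : powScale 1 β = β⁻¹ := by rw [powScale_eq hβ, Real.rpow_neg hβ0.le, Real.rpow_one]
  rw [Set.indicator_of_mem (show v ∈ {v : Edge 3 L → Fin 3 → ℝ | ‖linkEmbed L v‖ ≤ min (1 / 40) (powScale (1 / 2) β * btLog β)} from hr), one_mul,
    ← Real.exp_nat_mul, ← Real.exp_add, hp, inv_pow, div_inv_eq_mul]
  refine Real.exp_le_exp.2 ?_
  have hN := mul_norm_sq_le_balLevel L hβ v
  have hdef : balLevel L β v = β ^ 2 * ‖(gaugeModes L).starProjection x‖ ^ 2 + β * ‖x - (gaugeModes L).starProjection x‖ ^ 2 := rfl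
  have hS : 0 ≤ β * ‖x - (gaugeModes L).starProjection x‖ ^ 2 := by positivity
  push_cast
  nlinarith

/-! ## §3 Moments of the squared integrand -/

/-- ★★★ **MOMENTS OF THE SQUARED INTEGRAND ARE `O(1)` RELATIVE TO ITS MASS.**  `L ≥ 2`.  There are `A > 0` and `β₃` such that for `β ≥ β₃`, every `k : ℕ`, `D ≥ 0` and every
measurable `M` with `0 ≤ M v ≤ D·(balLevel β v + 1)^k`:
`∫ 𝟙S_β·M dπ ≤ A·(5e·2^k·4^d·k!·d!)·(c₂^{k+d})⁻¹·D·∫ 𝟙S_β dπ` (`c₂ = min 1 (2−2cos(2π/L))`). [cite: Luscher1983, §3] -/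
theorem sqIntegrand_moment_le (hL : 2 ≤ L) :
    ∃ A β₃ : ℝ, 0 < A ∧ 400 ≤ β₃ ∧ ∀ β : ℝ, β₃ ≤ β → ∀ (k : ℕ) (D : ℝ), 0 ≤ D → ∀ M : (Edge 3 L → Fin 3 → ℝ) → ℝ, Measurable M → (∀ v, 0 ≤ M v) →
      (∀ v, M v ≤ D * (balLevel L β v + 1) ^ k) →
      ∫ v, {v : Edge 3 L → Fin 3 → ℝ | ‖linkEmbed L v‖ ≤ min (1 / 40) (powScale (1 / 2) β * btLog β)}.indicator (fun _ => (1 : ℝ)) v *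
          (Real.exp (-(stiffGaussExp L (β / 2) β (linkEmbed L v))) ^ 2 * Real.exp (-(‖(gaugeModes L).starProjection (linkEmbed L v)‖ ^ 2 / powScale 1 β ^ 2))) * M v ∂orthoTransverse L ≤
        A * (5 * Real.exp 1 * 2 ^ k * 4 ^ Module.finrank ℝ ({e : Edge 3 L // ¬e.1 = 0} → Fin 3 → ℝ) * k.factorial * (Module.finrank ℝ ({e : Edge 3 L // ¬e.1 = 0} → Fin 3 → ℝ)).factorial) *
          ((min 1 (2 - 2 * Real.cos (2 * Real.pi / L))) ^ (k + Module.finrank ℝ ({e : Edge 3 L // ¬e.1 = 0} → Fin 3 → ℝ)))⁻¹ * D *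
        ∫ v, {v : Edge 3 L → Fin 3 → ℝ | ‖linkEmbed L v‖ ≤ min (1 / 40) (powScale (1 / 2) β * btLog β)}.indicator (fun _ => (1 : ℝ)) v *
          (Real.exp (-(stiffGaussExp L (β / 2) β (linkEmbed L v))) ^ 2 * Real.exp (-(‖(gaugeModes L).starProjection (linkEmbed L v)‖ ^ 2 / powScale 1 β ^ 2))) ∂orthoTransverse L := by
  haveI := isFiniteMeasure_orthoTransverse L
  obtain ⟨K, β₁, hK, hβ₁1, hmom⟩ := orthoTransverse_gauss_moment_le L
  obtain ⟨k₀, β₂, hk₀, hβ₂, hfloor⟩ := core_floor_of_exp_lower L (show (0 : ℝ) ≤ 99 by norm_num)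
  set c₂ : ℝ := min 1 (2 - 2 * Real.cos (2 * Real.pi / L)) with hc₂
  have hc0 : 0 < c₂ := lt_min one_pos (gap_pos (L := L) hL)
  have hc1 : c₂ ≤ 1 := min_le_left _ _
  set d := Module.finrank ℝ ({e : Edge 3 L // ¬e.1 = 0} → Fin 3 → ℝ) with hd
  refine ⟨K / k₀, max β₁ β₂, div_pos hK hk₀, hβ₂.trans (le_max_right _ _), fun β hβ k D hD M hMm hM0 hMle => ?_⟩
  have hβ1 : 1 ≤ β := hβ₁1.trans ((le_max_left _ _).trans hβ)
  -- abbreviations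
  set S : (Edge 3 L → Fin 3 → ℝ) → ℝ := fun v => {v : Edge 3 L → Fin 3 → ℝ | ‖linkEmbed L v‖ ≤ min (1 / 40) (powScale (1 / 2) β * btLog β)}.indicator (fun _ => (1 : ℝ)) v *
    (Real.exp (-(stiffGaussExp L (β / 2) β (linkEmbed L v))) ^ 2 * Real.exp (-(‖(gaugeModes L).starProjection (linkEmbed L v)‖ ^ 2 / powScale 1 β ^ 2))) with hSdef
  have hSm : Measurable S := measurable_sqIntegrand L β
  have hS0 : ∀ v, 0 ≤ S v := fun v => by rw [hSdef]; exact mul_nonneg (Set.indicator_nonneg (fun _ _ => zero_le_one) v) (by positivity)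
  have hS1 : ∀ v, S v ≤ 1 := fun v => by
    rw [hSdef]; dsimp only
    have h1 : Real.exp (-(stiffGaussExp L (β / 2) β (linkEmbed L v))) ^ 2 ≤ 1 :=
      pow_le_one₀ (Real.exp_pos _).le (Real.exp_le_one_iff.mpr (neg_nonpos.mpr (stiffGaussExp_nonneg _ _ _)))
    have h2 : Real.exp (-(‖(gaugeModes L).starProjection (linkEmbed L v)‖ ^ 2 / powScale 1 β ^ 2)) ≤ 1 := Real.exp_le_one_iff.mpr (neg_nonpos.mpr (by positivity))
    calc _ ≤ 1 * (1 * 1) := mul_le_mul (Set.indicator_le_self' (fun _ _ => zero_le_one) v) (mul_le_mul h1 h2 (Real.exp_pos _).le zero_le_one)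
          (by positivity) zero_le_one
      _ = 1 := by norm_num
  have hSsupp : ∀ v, S v ≠ 0 → ‖linkEmbed L v‖ ≤ min (1 / 40) (powScale (1 / 2) β * btLog β) := fun v hv => by
    by_contra hn
    exact hv (by rw [hSdef]; dsimp only; rw [Set.indicator_of_notMem (show v ∉ {v : Edge 3 L → Fin 3 → ℝ | ‖linkEmbed L v‖ ≤ _} from hn), zero_mul])
  have hcap : ∀ᵐ v ∂orthoTransverse L, v ∈ capBalancedSet L := by rw [ae_iff]; exact orthoTransverse_compl_capBalancedSet L
  -- numerator: the cap-restricted integrand is dominated by the Gaussian moment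
  set f : (Edge 3 L → Fin 3 → ℝ) → ℝ := (capBalancedSet L).indicator fun v => S v * M v with hfdef
  have hfm : Measurable f := (hSm.mul hMm).indicator (measurableSet_capBalancedSet L)
  have hf0 : ∀ v, 0 ≤ f v := fun v => Set.indicator_nonneg (fun v _ => mul_nonneg (hS0 v) (hM0 v)) v
  have hfle : ∀ v, f v ≤ D * (Real.exp (-(c₂ * balLevel L β v)) * (balLevel L β v + 1) ^ k) := fun v => by
    by_cases hv : v ∈ capBalancedSet L
    · rw [hfdef, Set.indicator_of_mem hv]
      calc S v * M v ≤ Real.exp (-(c₂ * balLevel L β v)) * (D * (balLevel L β v + 1) ^ k) :=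
            mul_le_mul (sqIntegrand_le_exp_neg L hL hβ1 hv) (hMle v) (hM0 v) (Real.exp_pos _).le
        _ = _ := by ring
    · rw [hfdef, Set.indicator_of_notMem hv]
      exact mul_nonneg hD (mul_nonneg (Real.exp_pos _).le (pow_nonneg (by linarith [balLevel_nonneg L (by linarith : (0 : ℝ) ≤ β) v]) _))
  have hfs : ∀ v, f v ≠ 0 → ‖linkEmbed L v‖ ≤ min (1 / 40) (powScale (1 / 2) β * btLog β) := fun v hv => by
    have hv' : v ∈ capBalancedSet L := by by_contra hn; exact hv (Set.indicator_of_notMem hn _)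
    rw [hfdef, Set.indicator_of_mem hv'] at hv
    exact hSsupp v (left_ne_zero_of_mul hv)
  have hnum := hmom β ((le_max_left _ _).trans hβ) c₂ hc0 hc1 k D hD f hfm hf0 hfle hfs
  have heq : ∫ v, S v * M v ∂orthoTransverse L = ∫ v, f v ∂orthoTransverse L :=
    integral_congr_ae (hcap.mono fun v hv => by rw [hfdef, Set.indicator_of_mem hv])
  -- denominator: the core floor
  have hden := hfloor β ((le_max_right _ _).trans hβ) S hSm hS0 ⟨1, hS1⟩ hSsupp (fun v _ hr => exp_neg_le_sqIntegrand L hβ1 hr)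
  have hint : Integrable S (orthoTransverse L) := integrable_of_measurable_abs_le _ hSm (C := 1) fun v => by rw [abs_of_nonneg (hS0 v)]; exact hS1 v
  have hden' : k₀ * (volume {w : {e : Edge 3 L // ¬e.1 = 0} → Fin 3 → ℝ | balLevel L β (balExt L w) ≤ 1}).toReal ≤ ∫ v, S v ∂orthoTransverse L :=
    hden.trans (setIntegral_le_integral hint (ae_of_all _ hS0))
  -- combine
  have hv0 : (volume {w : {e : Edge 3 L // ¬e.1 = 0} → Fin 3 → ℝ | balLevel L β (balExt L w) ≤ 1}).toReal ≤ (∫ v, S v ∂orthoTransverse L) / k₀ := by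
    rw [le_div_iff₀ hk₀, mul_comm]; exact hden'
  have hcoef : 0 ≤ K * D * (5 * Real.exp 1 * 2 ^ k * 4 ^ d * k.factorial * d.factorial) * (c₂ ^ (k + d))⁻¹ := by positivity
  calc ∫ v, S v * M v ∂orthoTransverse L = ∫ v, f v ∂orthoTransverse L := heq
    _ ≤ K * D * (5 * Real.exp 1 * 2 ^ k * 4 ^ d * k.factorial * d.factorial) * (c₂ ^ (k + d))⁻¹ *
          (volume {w : {e : Edge 3 L // ¬e.1 = 0} → Fin 3 → ℝ | balLevel L β (balExt L w) ≤ 1}).toReal := hnum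
    _ ≤ K * D * (5 * Real.exp 1 * 2 ^ k * 4 ^ d * k.factorial * d.factorial) * (c₂ ^ (k + d))⁻¹ * ((∫ v, S v ∂orthoTransverse L) / k₀) :=
        mul_le_mul_of_nonneg_left hv0 hcoef
    _ = K / k₀ * (5 * Real.exp 1 * 2 ^ k * 4 ^ d * k.factorial * d.factorial) * (c₂ ^ (k + d))⁻¹ * D * ∫ v, S v ∂orthoTransverse L := by
        field_simp

/-! ## §4 Weighted squared fibre mass at every slow datum -/

/-- ★★★ **WEIGHTED SQUARED FIBRE MASS, EVERY SLOW DATUM, ANY WINDOW CONSTANT.**  `L ≥ 2`; with `A, β₃` of `sqIntegrand_moment_le`: for `β ≥ β₃`, every `s K M u`, every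
`κ ≥ 0` with (P) `gaugeAvg (recordChi L s K M β) U ≤ N̄(β⁻¹)·(1+κ)` on the fat tube, every `k`, `D ≥ 0` and measurable `0 ≤ M_w ≤ D·(balLevel β + 1)^k`:
`∫ recordProfile β (x̂)²·M_w(x)·softWeight χ (orthoTube u x) dπ ≤ (1+κ)·A·(5e2^k4^dk!d!)·(c₂^{k+d})⁻¹·D·recordGamma L (recordProfile L) β` (lane A's `fibre_sq_mass_le` is `k = 0`, `K = 43`).
[cite: Luscher1983, §3] -/
theorem fibre_weighted_sq_mass_le (hL : 2 ≤ L) :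
    ∃ A β₃ : ℝ, 0 < A ∧ 400 ≤ β₃ ∧ ∀ β : ℝ, β₃ ≤ β → ∀ (s K M : ℝ) (u : GaugeConfig 3 1 SU2) (κ : ℝ), 0 ≤ κ →
      (∀ U ∈ fatTubeRho L (fun β => K * powScale s β) (fun b => M * (K * powScale s b)) β, gaugeAvg (recordChi L s K M β) U ≤ fpWeightBar L (powScale 1 β) * (1 + κ)) →
      ∀ (k : ℕ) (D : ℝ), 0 ≤ D → ∀ Mw : (Edge 3 L → Fin 3 → ℝ) → ℝ, Measurable Mw → (∀ v, 0 ≤ Mw v) → (∀ v, Mw v ≤ D * (balLevel L β v + 1) ^ k) →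
      ∫ x, recordProfile L β (linkEmbed L x) ^ 2 * Mw x * softWeight (recordChi L s K M β) (orthoTube L u x) ∂orthoTransverse L ≤
        (1 + κ) * (A * (5 * Real.exp 1 * 2 ^ k * 4 ^ Module.finrank ℝ ({e : Edge 3 L // ¬e.1 = 0} → Fin 3 → ℝ) * k.factorial *
            (Module.finrank ℝ ({e : Edge 3 L // ¬e.1 = 0} → Fin 3 → ℝ)).factorial) *
          ((min 1 (2 - 2 * Real.cos (2 * Real.pi / L))) ^ (k + Module.finrank ℝ ({e : Edge 3 L // ¬e.1 = 0} → Fin 3 → ℝ)))⁻¹ * D) * recordGamma L (recordProfile L) β := by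
  haveI := isFiniteMeasure_orthoTransverse L
  obtain ⟨A, β₃, hA, hβ₃, hmom⟩ := sqIntegrand_moment_le L hL
  refine ⟨A, β₃, hA, hβ₃, fun β hβ s K M u κ hκ hP k D hD Mw hMm hM0 hMle => ?_⟩
  have hβ1 : 1 ≤ β := by linarith
  set d := Module.finrank ℝ ({e : Edge 3 L // ¬e.1 = 0} → Fin 3 → ℝ) with hd
  set Nbar := fpWeightBar L (powScale 1 β) with hNbar
  have hNbar0 : 0 < Nbar := fpWeightBar_pos L (powScale_pos 1 β)
  set F := fatTubeRho L (fun β => K * powScale s β) (fun b => M * (K * powScale s b)) β with hFdef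
  set S : (Edge 3 L → Fin 3 → ℝ) → ℝ := fun v => {v : Edge 3 L → Fin 3 → ℝ | ‖linkEmbed L v‖ ≤ min (1 / 40) (powScale (1 / 2) β * btLog β)}.indicator (fun _ => (1 : ℝ)) v *
    (Real.exp (-(stiffGaussExp L (β / 2) β (linkEmbed L v))) ^ 2 * Real.exp (-(‖(gaugeModes L).starProjection (linkEmbed L v)‖ ^ 2 / powScale 1 β ^ 2))) with hSdef
  have hSm : Measurable S := measurable_sqIntegrand L β
  have hS0 : ∀ v, 0 ≤ S v := fun v => by rw [hSdef]; exact mul_nonneg (Set.indicator_nonneg (fun _ _ => zero_le_one) v) (by positivity)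
  -- pointwise on the cap: `Ω_c² M_w w_u ≤ N̄(1+κ)·S·M_w`
  have hpt : ∀ x ∈ capBalancedSet L, recordProfile L β (linkEmbed L x) ^ 2 * Mw x * softWeight (recordChi L s K M β) (orthoTube L u x) ≤ (Nbar * (1 + κ)) * (S x * Mw x) := by
    intro x hx
    have h := recordProfile_sq_mul_softWeight_eq s K M β u hx
    have hN : F.indicator (gaugeAvg (recordChi L s K M β)) (orthoTube L u x) ≤ Nbar * (1 + κ) := by
      by_cases hU : orthoTube L u x ∈ F
      · rw [Set.indicator_of_mem hU]; exact hP _ hU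
      · rw [Set.indicator_of_notMem hU]; positivity
    calc recordProfile L β (linkEmbed L x) ^ 2 * Mw x * softWeight (recordChi L s K M β) (orthoTube L u x)
        = (recordProfile L β (linkEmbed L x) ^ 2 * softWeight (recordChi L s K M β) (orthoTube L u x)) * Mw x := by ring
      _ = (S x * F.indicator (gaugeAvg (recordChi L s K M β)) (orthoTube L u x)) * Mw x := by rw [show recordProfile L β (linkEmbed L x) ^ 2 * _ = _ from h]
      _ ≤ (S x * (Nbar * (1 + κ))) * Mw x := mul_le_mul_of_nonneg_right (mul_le_mul_of_nonneg_left hN (hS0 x)) (hM0 x)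
      _ = (Nbar * (1 + κ)) * (S x * Mw x) := by ring
  have hcap : ∀ᵐ v ∂orthoTransverse L, v ∈ capBalancedSet L := by rw [ae_iff]; exact orthoTransverse_compl_capBalancedSet L
  have hc0 : 0 < min 1 (2 - 2 * Real.cos (2 * Real.pi / L)) := lt_min one_pos (gap_pos (L := L) hL)
  -- the cap-restricted majorant is bounded, hence integrable
  set f : (Edge 3 L → Fin 3 → ℝ) → ℝ := (capBalancedSet L).indicator fun v => S v * Mw v with hfdef
  have hfm : Measurable f := (hSm.mul hMm).indicator (measurableSet_capBalancedSet L)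
  have hf0 : ∀ v, 0 ≤ f v := fun v => Set.indicator_nonneg (fun v _ => mul_nonneg (hS0 v) (hM0 v)) v
  have hfB : ∀ v, f v ≤ D * (((min 1 (2 - 2 * Real.cos (2 * Real.pi / L))) ^ k)⁻¹ * (2 ^ k * k.factorial * Real.exp (1 / 2))) := fun v => by
    by_cases hv : v ∈ capBalancedSet L
    · rw [hfdef, Set.indicator_of_mem hv]
      calc S v * Mw v ≤ Real.exp (-(min 1 (2 - 2 * Real.cos (2 * Real.pi / L)) * balLevel L β v)) * (D * (balLevel L β v + 1) ^ k) :=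
            mul_le_mul (sqIntegrand_le_exp_neg L hL hβ1 hv) (hMle v) (hM0 v) (Real.exp_pos _).le
        _ = D * (Real.exp (-(min 1 (2 - 2 * Real.cos (2 * Real.pi / L)) * balLevel L β v)) * (balLevel L β v + 1) ^ k) := by ring
        _ ≤ _ := mul_le_mul_of_nonneg_left (exp_neg_mul_pow_le_const hc0 (min_le_left _ _) (balLevel_nonneg L (by linarith) v) k) hD
    · rw [hfdef, Set.indicator_of_notMem hv]; positivity
  have hfint : Integrable f (orthoTransverse L) := integrable_of_measurable_abs_le _ hfm fun v => by rw [abs_of_nonneg (hf0 v)]; exact hfB v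
  have hmono : ∫ x, recordProfile L β (linkEmbed L x) ^ 2 * Mw x * softWeight (recordChi L s K M β) (orthoTube L u x) ∂orthoTransverse L ≤
      ∫ x, (Nbar * (1 + κ)) * f x ∂orthoTransverse L := by
    refine integral_mono_of_nonneg (ae_of_all _ fun x => ?_) (hfint.const_mul _) (hcap.mono fun x hx => ?_)
    · exact mul_nonneg (mul_nonneg (sq_nonneg _) (hM0 x)) ((softWeight_recordChi_props (L := L) s K M β).2.2.1 _)
    · show _ ≤ (Nbar * (1 + κ)) * f x
      rw [hfdef, Set.indicator_of_mem hx]; exact hpt x hx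
  rw [integral_const_mul] at hmono
  have heq : ∫ x, f x ∂orthoTransverse L = ∫ x, S x * Mw x ∂orthoTransverse L := integral_congr_ae (hcap.mono fun v hv => by rw [hfdef, Set.indicator_of_mem hv])
  have hm := hmom β hβ k D hD Mw hMm hM0 hMle
  have hγ : recordGamma L (recordProfile L) β = Nbar * ∫ v, S v ∂orthoTransverse L := recordGamma_eq (L := L) β
  have hκ1 : 0 ≤ Nbar * (1 + κ) := by positivity
  calc ∫ x, recordProfile L β (linkEmbed L x) ^ 2 * Mw x * softWeight (recordChi L s K M β) (orthoTube L u x) ∂orthoTransverse L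
      ≤ (Nbar * (1 + κ)) * ∫ x, f x ∂orthoTransverse L := hmono
    _ = (Nbar * (1 + κ)) * ∫ x, S x * Mw x ∂orthoTransverse L := by rw [heq]
    _ ≤ (Nbar * (1 + κ)) * (A * (5 * Real.exp 1 * 2 ^ k * 4 ^ d * k.factorial * d.factorial) * ((min 1 (2 - 2 * Real.cos (2 * Real.pi / L))) ^ (k + d))⁻¹ * D *
          ∫ v, S v ∂orthoTransverse L) := mul_le_mul_of_nonneg_left hm hκ1
    _ = (1 + κ) * (A * (5 * Real.exp 1 * 2 ^ k * 4 ^ d * k.factorial * d.factorial) * ((min 1 (2 - 2 * Real.cos (2 * Real.pi / L))) ^ (k + d))⁻¹ * D) *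
          (Nbar * ∫ v, S v ∂orthoTransverse L) := by ring
    _ = _ := by rw [← hγ]

end Summit.QuantumFields.YangMills.Theorems.FemtoTransferGap.TwoLattice.ConstTube

end
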